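import Literature.NumberTheory.Automorphic.HarrisLanTaylorThorneTwistedPairLimit
import Literature.NumberTheory.Automorphic.AutomorphicInductionUnitaryCharacterCubicArchimedeanAssembly
import Literature.NumberTheory.Automorphic.AutomorphicRepsGLSatakeFlathProofs
import Literature.NumberTheory.GaloisRepresentations.FrobeniusDensityTheorem
import Literature.FieldTheory.AlgClosed.PadicAlgClEquivComplex
import HarnessLib

/-!
# `HarrisLanTaylorThorne2016_twistedPairLimit_two` is mis-stated: the proof

Topic `Literature/NumberTheory/Automorphic`; a sibling proofs file (theorems only: no definitions, no
named facts) of `HarrisLanTaylorThorneTwistedPairLimit.lean` (the other sibling,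
`HarrisLanTaylorThorneTwistedPairLimitProofs.lean`, treats Cor. 1.3).

The named fact `Literature.NumberTheory.Automorphic.HarrisLanTaylorThorne2016_twistedPairLimit_two`
(Harris–Lan–Taylor–Thorne 2016, §6 at `n = 2`, "automorphic half") prescribes at the good places `v`
the Frobenius polynomial `arithFrobPolyOfSatake ι q_v 2 α_v · ∏_{b ∈ B_v} (X - b q_v^{-2N})` of
Cor. 6.27's `R_{p,ı}(π, N) = r ⊕ r^{c,∨} ε_p^{1-2n-2N}` and asserts that it is an algebra-valued
`p`-adic limit of the base-change Frobenius polynomials `Q_i v = arithFrobPolyOfSatake ι q_v 4 β` of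
cuspidal automorphic representations `σ'_i` of the quasi-split unitary group `U_{K/Fp}(4)`.  The
source says otherwise: "Take `R_{p,ı}(π, N) = R_p(ı⁻¹(π^∞‖det‖^N)) ⊗ ε_p^{-N}`" (proof of Cor. 6.27,
Res. Math. Sci. 3:37, p. 225) — the limit of classical cusp forms is the eigensystem of
`ı⁻¹ Ind(π^∞‖det‖^N)`, with Galois avatar `R_p(ı⁻¹(π^∞‖det‖^N)) = R_{p,ı}(π, N) ⊗ ε_p^{N} =
r ε_p^{N} ⊕ r^{c,∨} ε_p^{1-2n-N}`.  The HLTT-faithful statement keeps every clause of the fact and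
replaces the prescription at the good places by the arithmetic-Frobenius polynomial of `R_p(Π_N)`,
`arithFrobPolyOfSatake ι q_v 2 (α_v · q_v^{-N}) · ∏_{b ∈ B_v} (X - b q_v^{-N})` (`α_v q_v^{-N}` is the
Satake parameter of `(π‖det‖^N)_v`, `ε_p(Frob_v^{arith}) = q_v`); it is recorded for filing under
the name `HarrisLanTaylorThorne2016_inducedPairLimit_two` by a definition seat (D-0026: a proving seat
may not mint a named fact), and consumers wanting Cor. 6.27's `R_{p,ı}(π, N)` must twist the limit
Galois representation by `ε_p^{-N}` after the pseudo-representation theorem, as the paper does.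
Here it is PROVED that the fact as typed is absurd:

* `eval_zero_arithFrobPolyOfSatake_four_of_isBaseChangeParam` — at a place `w` with `c w = w` a
  base-change torus parameter of `U(4)` has `β₃ = β₀⁻¹`, `β₂ = β₁⁻¹`
  (`UnitaryGroup.IsBaseChangeParam`, Mínguez 2011 Thm. 4.1 / HLTT §1.3 `χ ∘ N`), so
  `arithFrobPolyOfSatake ι q 4 {β_i}` has constant coefficient EXACTLY `q^{-6}` (conjugate
  self-duality of base change: the `4`-dimensional Galois representations of §1 are
  `ε_p^{-3}`-polarised);
* `not_HarrisLanTaylorThorne2016_twistedPairLimit_two_of_inertPlace` — given the data of the fact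
  and ONE inert good place `w` (fixed by `cK`, over a rational prime `q ≠ p` unramified in `K` above
  which `π` is unramified), the fact is contradictory: the integer polynomial `q_w^6 X_{(w,0)} - 1`
  vanishes on every `Q_i`, so the transfer clause forces `(P w).coeff 0 = q_w^{-6}` for all
  `N ≥ N₀`, while the prescription gives `c · q_w^{-4N}` with `c` independent of `N`;
  `N = N₀, N₀ + 1` yield `q_w^4 = 1`;
* `HarrisLanTaylorThorne2016_twistedPairLimit_two.elim` — such a place always exists (infinitely
  many places of `Fp` are inert in `K`: `frequently_forall_inertiaDeg_eq_two`, from the tree's proved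
  Chebotarev theorem; Flath's `hasSatakeParamAt_cofinite_holds`; finiteness of the ramified primes
  via the different; `HeightOneSpectrum.eq_of_inertiaDeg_eq_two`), so the fact together with ANY
  instance of its data (`K/Fp` CM with `cK`, `E₀ ⊆ K` imaginary quadratic with `p` split, `π`
  regular algebraic cuspidal on `GL₂(𝔸_K)`, `ι`) proves `False`: as typed it is equivalent to the
  non-existence of its data, and is not a rendering of HLTT §6;
* `eval_zero_inducedPair_prescription` — the corrected prescription
  `arithFrobPolyOfSatake ι q 2 (α q^{-N}) · ∏_{b} (X - b q^{-N})` has constant coefficient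
  INDEPENDENT of `N` (it passes the obstruction).
* `inducedPairPrescription_eq_scaleRoots` — the corrected prescription is the typed one with every
  root multiplied by `q^{N}` (`Polynomial.scaleRoots _ (q ^ N)`), i.e. its Tate twist by `ε_p^{N}`
  (`ε_p(Frob^{arith}) = q`): the polynomial form of `R_p(ı⁻¹(π^∞‖det‖^N)) = R_{p,ı}(π, N) ⊗ ε_p^{N}`,
  for consumers who must undo the twist after the pseudo-representation theorem
  (helper `multisetProd_scaleRoots`).
* `HarrisLanTaylorThorne2016_twistedPairLimit_two_iff_forall_not_isRegularAlgebraic` — the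
  kernel-checked form of "as typed it is equivalent to the non-existence of its data": the fact
  holds IF AND ONLY IF no CM field `K` of its shape (`K/Fp` quadratic, `Fp` totally real, with
  involution `cK`, containing an imaginary quadratic `E₀` in which some prime `p` splits) carries a
  regular algebraic cuspidal automorphic representation of `GL₂(𝔸_K)` (`.elim` and Steinitz'
  `PadicAlgCl.nonempty_ringEquiv_complex`, `ℚ̄_p ≃+* ℂ`).  Its mathematical content is therefore nil
  as a rendering of HLTT §6 (and it is false in fact — e.g. `Fp = ℚ`, `K = E₀ = ℚ(i)`, `p = 5`,
  `π` the quadratic base change to `ℚ(i)` of the non-CM newform of weight `2` and level `11` —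
  although no cuspidal `π` is constructible in the tree, so `¬` the fact is not proved here).

Sequel (2026-08-17).  The third sibling `HarrisLanTaylorThorneTwistedPairLimitVsBaseChange.lean`
produces such a `π` modulo Arthur–Clozel's quadratic base change (Ramanujan's `Δ`, the tree's proved
dictionary `f ↦ π_f` over `ℚ`, base change to `ℚ(√-23)`):
`HarrisLanTaylorThorne2016_twistedPairLimit_two.not_of_arthurClozel :
ArthurClozel1989_strongLifting_cuspidal → ArthurClozel1989_strongLifting_archimedean → ¬` the fact.
Following the verdict clean-up of 2026-08-17 the fact is RETIRED FROM LITERATURE DEBT as refuted: it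
is kept statement byte-for-byte in `HarrisLanTaylorThorneTwistedPairLimit.lean` but carries
`@[deprecated]` (pointer to `.elim`, `_iff_forall_not_isRegularAlgebraic`, `.not_of_arthurClozel` and
to the corrected `HarrisLanTaylorThorne2016_inducedPairLimit_two`, now filed in that file), so the
three theorems below that must name it — they ARE its refutation — switch `linter.deprecated` off
for themselves alone (each with a REMOVE-WHEN note); nothing else changed.

## References

* M. Harris, K.-W. Lan, R. Taylor, J. Thorne, *On the rigid cohomology of certain Shimura
  varieties*, Res. Math. Sci. 3:37 (2016): §1.3 (pp. 28–30), Cor. 6.26–6.27 and the proof of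
  Cor. 6.27 (p. 225). [HarrisLanTaylorThorneRMS2016]
* A. Mínguez, *Unramified representations of unitary groups* (2011), Thm. 4.1. [Minguez2011]
-/

noncomputable section

open scoped NumberField Polynomial
open NumberField IsDedekindDomain Polynomial
open Literature.NumberTheory.Automorphic

namespace Literature.NumberTheory.Automorphic

section Evidence

variable {p : ℕ} [Fact p.Prime]

/-- An element of `ℚ̄_p` of norm at most `p^{-m}` for every `m` is zero. [folklore] -/
theorem PadicAlgCl.eq_zero_of_forall_norm_le_zpow_neg {z : PadicAlgCl p}
    (h : ∀ m : ℕ, ‖z‖ ≤ (p : ℝ) ^ (-(m : ℤ))) : z = 0 := by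
  by_contra hz
  have hpos : 0 < ‖z‖ := norm_pos_iff.mpr hz
  have hp1 : ((p : ℝ))⁻¹ < 1 :=
    inv_lt_one_of_one_lt₀ (by exact_mod_cast (Fact.out : p.Prime).one_lt)
  obtain ⟨m, hm⟩ := exists_pow_lt_of_lt_one hpos hp1
  have := h m
  rw [zpow_neg, zpow_natCast, ← inv_pow] at this
  linarith

/-- At a place `w` fixed by `c` (inert), a base-change torus parameter `β` of `U(4)` satisfies
`β₃ = β₀⁻¹`, `β₂ = β₁⁻¹`, so the constant coefficient of `arithFrobPolyOfSatake ι q 4 {β_i}` is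
`q^{-6}`. [folklore] -/
theorem eval_zero_arithFrobPolyOfSatake_four_of_isBaseChangeParam
    {Fp K : Type} [Field Fp] [NumberField Fp] [Field K] [NumberField K] [Algebra Fp K]
    {cK : K ≃ₐ[Fp] K} (ι : PadicAlgCl p ≃+* ℂ) {w : HeightOneSpectrum (𝓞 K)} (hw : cK • w = w)
    {β : Fin 4 → ℂ} (hβ : UnitaryGroup.IsBaseChangeParam Fp K cK 4 w β) {q : ℕ} (hq : 0 < q) :
    (arithFrobPolyOfSatake ι q 4 (Finset.univ.val.map β)).eval 0 = ((q : PadicAlgCl p) ^ 6)⁻¹ := by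
  obtain ⟨hne, hsymm⟩ := hβ
  have h3 : β 3 = (β 0)⁻¹ := (hsymm hw 0).1
  have h2 : β 2 = (β 1)⁻¹ := (hsymm hw 1).1
  have h0 := hne 0
  have h1 := hne 1
  set s : ℂ := ((Real.sqrt (q : ℝ) : ℝ) : ℂ) with hs_def
  have hs2 : s ^ 2 = (q : ℂ) := by
    rw [hs_def, ← Complex.ofReal_pow, Real.sq_sqrt (Nat.cast_nonneg _), Complex.ofReal_natCast]
  have hs0 : s ≠ 0 := by
    intro h
    have : (q : ℂ) = 0 := by rw [← hs2, h]; simp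
    exact (Nat.pos_iff_ne_zero.mp hq) (by exact_mod_cast this)
  have hprod : ∀ i : Fin 4,
      (X - C (ι.symm (s ^ (4 - 1) * β i)⁻¹) : (PadicAlgCl p)[X]).eval 0 = -(ι.symm (s ^ 3 * β i)⁻¹) := by
    intro i; simp
  unfold arithFrobPolyOfSatake
  rw [Multiset.map_map, Polynomial.eval_multiset_prod, Multiset.map_map]
  change (Finset.univ.val.map fun i : Fin 4 => ((X - C (ι.symm (s ^ (4 - 1) * β i)⁻¹) : (PadicAlgCl p)[X]).eval 0)).prod = _
  rw [← Finset.prod_eq_multiset_prod]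
  simp_rw [hprod]
  rw [Fin.prod_univ_four]
  have hc : (s ^ 3 * β 0)⁻¹ * (s ^ 3 * β 1)⁻¹ * (s ^ 3 * β 2)⁻¹ * (s ^ 3 * β 3)⁻¹ = ((q : ℂ) ^ 6)⁻¹ := by
    rw [h2, h3, ← hs2]
    field_simp
  calc -ι.symm (s ^ 3 * β 0)⁻¹ * -ι.symm (s ^ 3 * β 1)⁻¹ * -ι.symm (s ^ 3 * β 2)⁻¹ * -ι.symm (s ^ 3 * β 3)⁻¹
      = ι.symm ((s ^ 3 * β 0)⁻¹ * (s ^ 3 * β 1)⁻¹ * (s ^ 3 * β 2)⁻¹ * (s ^ 3 * β 3)⁻¹) := by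
        simp only [map_mul]; ring
    _ = ((q : PadicAlgCl p) ^ 6)⁻¹ := by rw [hc]; simp

-- names the `@[deprecated]` record `HarrisLanTaylorThorne2016_twistedPairLimit_two` of
-- `HarrisLanTaylorThorneTwistedPairLimit.lean` on purpose: this IS (the local step of) its refutation
-- (verdict clean-up 2026-08-17); REMOVE-WHEN the record is deleted from that file
set_option linter.deprecated false in
/-- **The typed `HarrisLanTaylorThorne2016_twistedPairLimit_two` fails in every instance admitting an
inert good place.**  If the data of the fact exist together with ONE finite place `w` of `K` fixed by
`cK` (inert over `Fp`), lying over a rational prime `q ≠ p` unramified in `K` above which `π` is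
unramified, then the fact is contradictory: at such `w` every base-change Frobenius polynomial
`Q_i w = arithFrobPolyOfSatake ι q_w 4 β` of the approximating family has constant coefficient EXACTLY
`q_w^{-6}` (`β₃ = β₀⁻¹`, `β₂ = β₁⁻¹`), so the integer polynomial `q_w^6 X_{(w,0)} - 1` vanishes on the
family and the transfer clause forces `(P w).coeff 0 = q_w^{-6}` for every `N ≥ N₀`, whereas the
prescribed `(P w).coeff 0 = c · q_w^{-4N}` with `c` independent of `N`; `N = N₀, N₀ + 1` give
`q_w^4 = 1`.  (The prescription of the fact is the Frobenius polynomial of HLTT's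
`R_{p,ı}(π, N) = R_p(ı⁻¹(π^∞‖det‖^N)) ⊗ ε_p^{-N}` (proof of Cor. 6.27, p. 225), which is
`ε^{-3-2N}`-polarised; limits of `U(4)`-eigensystems are `ε^{-3}`-polarised.  The automorphic limit
statement of §6 concerns `R_p(ı⁻¹(π^∞‖det‖^N))` itself; see the module docstring for the
corrected prescription.)
[cite: HarrisLanTaylorThorneRMS2016, proof of Cor. 6.27 (p. 225); §1.3 (pp. 29–30, BC(Π)_{cw} = Π_w^{∨,c}, χ ∘ N)] -/
theorem not_HarrisLanTaylorThorne2016_twistedPairLimit_two_of_inertPlace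
    (Fp K : Type) [Field Fp] [NumberField Fp] [Field K] [NumberField K] [Algebra Fp K]
    (cK : K ≃ₐ[Fp] K) (hFp : IsTotallyReal Fp) (hdeg : Module.finrank Fp K = 2) (hc : cK ≠ 1)
    (hK : IsTotallyComplex K) (hcpt : isCompact_glFiniteIntegralLevel 2 K) (p : ℕ) [Fact p.Prime]
    (E₀ : IntermediateField ℚ K) (hE₀ : Module.finrank ℚ E₀ = 2 ∧ IsTotallyComplex E₀)
    (hsplit : HasTwoPrimesOver E₀ p) (π : CuspidalAutomorphicRepData 2 K hcpt)
    (hπ : π.1.IsRegularAlgebraic) (ι : PadicAlgCl p ≃+* ℂ)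
    (w : HeightOneSpectrum (𝓞 K)) (hw : cK • w = w) (q : ℕ) (hq : q.Prime) (hqp : q ≠ p)
    (hqw : ((q : ℕ) : 𝓞 K) ∈ w.asIdeal)
    (hunr : Algebra.IsUnramifiedIn (𝓞 K) (Ideal.span {(q : ℤ)}))
    (hπq : π.1.IsUnramifiedAbove q) :
    ¬ HarrisLanTaylorThorne2016_twistedPairLimit_two := by
  intro h
  obtain ⟨N₀, B, hB, hN⟩ := h Fp K cK hFp hdeg hc hK hcpt p E₀ hE₀ hsplit π hπ ι
  have hgood : ∃ q : ℕ, q.Prime ∧ q ≠ p ∧ ((q : ℕ) : 𝓞 K) ∈ w.asIdeal ∧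
      Algebra.IsUnramifiedIn (𝓞 K) (Ideal.span {(q : ℤ)}) ∧ π.1.IsUnramifiedAbove q :=
    ⟨q, hq, hqp, hqw, hunr, hπq⟩
  obtain ⟨α, hα⟩ := hπq w hqw
  -- `p ∉ w`: `w` contains the prime `q ≠ p`
  have hpw : ((p : ℕ) : 𝓞 K) ∉ w.asIdeal := by
    intro hpw
    have hcop : IsCoprime (q : ℤ) (p : ℤ) :=
      Nat.isCoprime_iff_coprime.mpr ((Nat.coprime_primes hq Fact.out).mpr hqp)
    obtain ⟨a, b, hab⟩ := hcop
    refine w.isPrime.ne_top (Ideal.eq_top_iff_one _ |>.mpr ?_)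
    have h1 : ((a : 𝓞 K) * (q : ℕ) + (b : 𝓞 K) * (p : ℕ) : 𝓞 K) = 1 := by
      have := congrArg (Int.cast : ℤ → 𝓞 K) hab
      push_cast at this
      exact this
    rw [← h1]
    exact w.asIdeal.add_mem (w.asIdeal.mul_mem_left _ hqw) (w.asIdeal.mul_mem_left _ hpw)
  obtain ⟨b₁, b₂, hBw⟩ := Multiset.card_eq_two.mp (hB w).1
  set qw : ℕ := w.residueCard with hqw_def
  have hqw1 : 1 < qw := w.one_lt_residueCard
  have hqw0 : (qw : PadicAlgCl p) ≠ 0 := by exact_mod_cast (by omega : qw ≠ 0)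
  set a₀ : PadicAlgCl p := (arithFrobPolyOfSatake ι qw 2 α).eval 0 with ha₀
  -- for every `N ≥ N₀`: `qw ^ 6 * (a₀ * b₁ b₂ * qw^{-4N}) = 1`
  have key : ∀ N, N₀ ≤ N →
      (qw : PadicAlgCl p) ^ 6 * (a₀ * (b₁ * b₂) * (((qw : PadicAlgCl p)⁻¹) ^ (2 * N)) ^ 2) = 1 := by
    intro N hNle
    obtain ⟨E, S, P, -, -, hSgood, -, hP, -, hlim⟩ := hN N hNle
    have hwS : w ∉ S := hSgood w hgood
    have hPw : P w = arithFrobPolyOfSatake ι qw 2 α *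
        ((B w).map fun b ↦ X - C (b * ((qw : PadicAlgCl p)⁻¹) ^ (2 * N))).prod := hP w hgood α hα
    have hev : (P w).eval 0 = a₀ * (b₁ * b₂) * (((qw : PadicAlgCl p)⁻¹) ^ (2 * N)) ^ 2 := by
      rw [hPw, Polynomial.eval_mul, Polynomial.eval_multiset_prod, Multiset.map_map, hBw]
      simp only [Function.comp_def, Polynomial.eval_sub, Polynomial.eval_X, Polynomial.eval_C,
        Multiset.insert_eq_cons, Multiset.map_cons, Multiset.map_singleton, Multiset.prod_cons,
        Multiset.prod_singleton]
      rw [← ha₀]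
      ring
    classical
    set F : MvPolynomial (HeightOneSpectrum (𝓞 K) × ℕ) ℤ :=
      MvPolynomial.C ((qw : ℤ) ^ 6) * MvPolynomial.X (w, 0) - 1 with hF
    have hFvars : ∀ vk ∈ F.vars, vk.1 ∉ S ∧ ((p : ℕ) : 𝓞 K) ∉ vk.1.asIdeal := by
      intro vk hvk
      have hsub : F.vars ⊆ {(w, 0)} := by
        refine (MvPolynomial.vars_sub_subset _).trans (Finset.union_subset ?_ ?_)
        · refine (MvPolynomial.vars_mul _ _).trans (Finset.union_subset ?_ ?_)
          · rw [MvPolynomial.vars_C]; exact Finset.empty_subset _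
          · rw [MvPolynomial.vars_X]
        · rw [MvPolynomial.vars_one]; exact Finset.empty_subset _
      have := Finset.mem_singleton.mp (hsub hvk)
      subst this
      exact ⟨hwS, hpw⟩
    have hFeval : ∀ R : HeightOneSpectrum (𝓞 K) → (PadicAlgCl p)[X],
        MvPolynomial.aeval (fun vk : HeightOneSpectrum (𝓞 K) × ℕ => (R vk.1).coeff vk.2) F =
          (qw : PadicAlgCl p) ^ 6 * (R w).coeff 0 - 1 := by
      intro R
      simp [hF, map_sub, map_mul, MvPolynomial.aeval_X]
    have hz : ∀ m : ℕ, ‖(qw : PadicAlgCl p) ^ 6 * (P w).coeff 0 - 1‖ ≤ (p : ℝ) ^ (-(m : ℤ)) := by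
      intro m
      obtain ⟨r, hcpt4, σ', Q, δ, hδ, -, hQ, htrans⟩ := hlim m
      rw [← hFeval P]
      refine htrans F hFvars fun i => ?_
      obtain ⟨-, ⟨β, hβ⟩, hQi⟩ := hQ i w hwS hpw
      have hQiw : Q i w = arithFrobPolyOfSatake ι qw 4 β := hQi β hβ
      obtain ⟨𝔫, β', -, -, -, hbc, rfl, -⟩ := hβ
      rw [hFeval (Q i), hQiw, Polynomial.coeff_zero_eq_eval_zero,
        eval_zero_arithFrobPolyOfSatake_four_of_isBaseChangeParam ι hw hbc (by omega : 0 < qw),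
        mul_inv_cancel₀ (pow_ne_zero _ hqw0), sub_self, norm_zero]
      exact hδ.le
    have hz0 := PadicAlgCl.eq_zero_of_forall_norm_le_zpow_neg hz
    rw [Polynomial.coeff_zero_eq_eval_zero, hev, sub_eq_zero] at hz0
    exact hz0
  have h1 := key N₀ le_rfl
  have h2 := key (N₀ + 1) (Nat.le_succ _)
  have hu : ((qw : PadicAlgCl p)⁻¹) ^ 4 = 1 := by
    calc ((qw : PadicAlgCl p)⁻¹) ^ 4
        = (qw : PadicAlgCl p) ^ 6 * (a₀ * (b₁ * b₂) * (((qw : PadicAlgCl p)⁻¹) ^ (2 * N₀)) ^ 2) *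
            ((qw : PadicAlgCl p)⁻¹) ^ 4 := by rw [h1, one_mul]
      _ = (qw : PadicAlgCl p) ^ 6 * (a₀ * (b₁ * b₂) * (((qw : PadicAlgCl p)⁻¹) ^ (2 * (N₀ + 1))) ^ 2) := by
            ring
      _ = 1 := h2
  have hq4 : (qw : PadicAlgCl p) ^ 4 = 1 := by
    have := congrArg (·⁻¹) hu
    simpa only [inv_pow, inv_inv, inv_one] using this
  have hq4' : qw ^ 4 = 1 := by exact_mod_cast hq4
  have : 1 < qw ^ 4 := Nat.one_lt_pow (by norm_num) hqw1
  omega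

-- names the `@[deprecated]` record `HarrisLanTaylorThorne2016_twistedPairLimit_two` of
-- `HarrisLanTaylorThorneTwistedPairLimit.lean` on purpose: this IS its (unconditional) refutation
-- (verdict clean-up 2026-08-17); REMOVE-WHEN the record is deleted from that file
set_option linter.deprecated false in
/-- **The typed `HarrisLanTaylorThorne2016_twistedPairLimit_two` is vacuous-or-false: together with
ANY instance of its hypotheses it yields `False`.**  An inert good place as in
`not_HarrisLanTaylorThorne2016_twistedPairLimit_two_of_inertPlace` always exists: infinitely many
places of `Fp` are inert in the quadratic `K/Fp` (`frequently_forall_inertiaDeg_eq_two`, from the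
tree's PROVED Chebotarev theorem), all but finitely many of them are unramified in `K/Fp`, lie over
rational primes unramified in `K` (finitely many primes divide the different) and above which `π` is
unramified (Flath, `hasSatakeParamAt_cofinite_holds`), and avoid `p`; above such a place there is a
single place `w` of `K` (`HeightOneSpectrum.eq_of_inertiaDeg_eq_two`), so `cK • w = w`.  Hence the
fact, as typed, is equivalent to the non-existence of its data (a regular algebraic cuspidal `π` on
`GL₂` over a CM field containing an imaginary quadratic field in which `p` splits) — it does not
render Harris–Lan–Taylor–Thorne's §6, whose automorphic limit statement concerns
`R_p(ı⁻¹(π^∞‖det‖^N)) = R_{p,ı}(π, N) ⊗ ε_p^{N}` (module docstring).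
[cite: HarrisLanTaylorThorneRMS2016, proof of Cor. 6.27 (p. 225)] -/
theorem HarrisLanTaylorThorne2016_twistedPairLimit_two.elim
    (h : HarrisLanTaylorThorne2016_twistedPairLimit_two)
    (Fp K : Type) [Field Fp] [NumberField Fp] [Field K] [NumberField K] [Algebra Fp K]
    (cK : K ≃ₐ[Fp] K) (hFp : IsTotallyReal Fp) (hdeg : Module.finrank Fp K = 2) (hc : cK ≠ 1)
    (hK : IsTotallyComplex K) (hcpt : isCompact_glFiniteIntegralLevel 2 K) (p : ℕ) [Fact p.Prime]
    (E₀ : IntermediateField ℚ K) (hE₀ : Module.finrank ℚ E₀ = 2 ∧ IsTotallyComplex E₀)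
    (hsplit : HasTwoPrimesOver E₀ p) (π : CuspidalAutomorphicRepData 2 K hcpt)
    (hπ : π.1.IsRegularAlgebraic) (ι : PadicAlgCl p ≃+* ℂ) : False := by
  classical
  -- `K/Fp` is Galois
  haveI : FiniteDimensional Fp K := Module.finite_of_finrank_eq_succ hdeg
  have hcard : Fintype.card (K ≃ₐ[Fp] K) = Module.finrank Fp K := by
    refine le_antisymm AlgEquiv.card_le ?_
    rw [hdeg]
    exact Fintype.one_lt_card_iff_nontrivial.2 ⟨⟨cK, 1, hc⟩⟩
  haveI : IsGalois Fp K :=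
    IsGalois.of_card_aut_eq_finrank Fp K (by rw [Nat.card_eq_fintype_card, hcard])
  -- rational primes below the places of `K`; the finite set of bad rational primes
  choose f hf using fun w : HeightOneSpectrum (𝓞 K) ↦ exists_natPrime_natCast_mem w
  have hR : {w : HeightOneSpectrum (𝓞 K) | ¬ Algebra.IsUnramifiedAt ℤ w.asIdeal}.Finite := by
    refine (Ideal.finite_factors (differentIdeal_ne_bot (A := ℤ) (B := 𝓞 K))).subset
      fun w hw ↦ ?_
    simp only [Set.mem_setOf_eq] at hw ⊢
    by_contra hdvd
    exact hw ((not_dvd_differentIdeal_iff (A := ℤ)).mp hdvd)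
  have hcof : {w : HeightOneSpectrum (𝓞 K) | ¬ π.1.IsUnramifiedAt w}.Finite :=
    π.1.hasSatakeParamAt_cofinite_holds
  set Bad : Set ℕ := insert p
    (f '' ({w | ¬ Algebra.IsUnramifiedAt ℤ w.asIdeal} ∪ {w | ¬ π.1.IsUnramifiedAt w})) with hBad
  have hBadfin : Bad.Finite := ((hR.union hcof).image f).insert p
  have hB : ∀ q : ℕ, q.Prime → q ∉ Bad → q ≠ p ∧ ∀ v : HeightOneSpectrum (𝓞 K),
      ((q : ℕ) : 𝓞 K) ∈ v.asIdeal → Algebra.IsUnramifiedAt ℤ v.asIdeal ∧ π.1.IsUnramifiedAt v := by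
    intro q hq hqB
    refine ⟨fun hqp => hqB (by rw [hqp]; exact Set.mem_insert _ _), fun v hv => ?_⟩
    have hfv : f v = q := natPrime_eq_of_natCast_mem (hf v).1 hq (hf v).2 hv
    by_contra h'
    rw [not_and_or] at h'
    exact hqB (Set.mem_insert_of_mem _
      ⟨v, by simpa [Set.mem_union, Set.mem_setOf_eq] using h', hfv⟩)
  -- the places of `K` over a given rational prime: finitely many
  have hover : ∀ {q : ℕ}, q ≠ 0 →
      {v : HeightOneSpectrum (𝓞 K) | ((q : ℕ) : 𝓞 K) ∈ v.asIdeal}.Finite := by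
    intro q hq
    have hne : Ideal.span {((q : ℕ) : 𝓞 K)} ≠ ⊥ := by
      rw [Ne, Ideal.span_singleton_eq_bot]
      exact_mod_cast hq
    convert Ideal.finite_factors hne using 2 with v
    simp [Ideal.dvd_span_singleton]
  have hgoodw : ∀ᶠ w : HeightOneSpectrum (𝓞 K) in Filter.cofinite, f w ∉ Bad := by
    rw [Filter.eventually_cofinite]
    have hsub : {w : HeightOneSpectrum (𝓞 K) | ¬ (f w ∉ Bad)} ⊆
        ⋃ q ∈ Bad, {v | ((q : ℕ) : 𝓞 K) ∈ v.asIdeal} := by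
      intro w hw
      simp only [Set.mem_setOf_eq, not_not] at hw
      exact Set.mem_biUnion hw (hf w).2
    refine Set.Finite.subset (hBadfin.biUnion fun q hq => hover ?_) hsub
    rcases hq with rfl | ⟨w, -, rfl⟩
    · exact Nat.Prime.ne_zero Fact.out
    · exact (hf w).1.ne_zero
  -- a place of `Fp`, inert and unramified in `K`, all of whose overplaces are good
  have hev : ∀ᶠ v : HeightOneSpectrum (𝓞 Fp) in Filter.cofinite,
      Algebra.IsUnramifiedIn (𝓞 K) v.asIdeal ∧
        ∀ w : HeightOneSpectrum (𝓞 K), w.asIdeal.under (𝓞 Fp) = v.asIdeal → f w ∉ Bad :=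
    (Filter.eventually_cofinite.2
      (GaloisRepresentations.finite_setOf_not_isUnramifiedIn Fp K)).and
      (eventually_forall_under_eq hgoodw)
  obtain ⟨v, hinert, hvK, hvgood⟩ :=
    ((frequently_forall_inertiaDeg_eq_two (F := Fp) (K := K) hdeg).and_eventually hev).exists
  obtain ⟨w, hw⟩ := exists_above (E := K) v
  have hw2 := hinert w hw
  -- `cK • w = w`: there is a single place of `K` above the inert `v`
  have hcw : (cK • w).asIdeal.under (𝓞 Fp) = v.asIdeal := by
    rw [HeightOneSpectrum.smul_asIdeal, Ideal.under_smul]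
    exact hw
  have hfix : cK • w = w := HeightOneSpectrum.eq_of_inertiaDeg_eq_two hdeg hw hcw hw2 hvK
  -- the rational prime `q` below `w` is good
  have hq : (f w).Prime := (hf w).1
  obtain ⟨hqp, hgood⟩ := hB (f w) hq (hvgood w hw)
  have hKq : Algebra.IsUnramifiedIn (𝓞 K) (Ideal.span {(f w : ℤ)}) := by
    intro P hP hover'
    have hqP : ((f w : ℕ) : 𝓞 K) ∈ P := by
      have h1 := Ideal.mem_span_singleton_self (f w : ℤ)
      rw [hover'.over, Ideal.under_def, Ideal.mem_comap] at h1
      simpa using h1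
    have hP0 : P ≠ ⊥ := by
      intro h0
      rw [h0, Ideal.mem_bot] at hqP
      exact hq.ne_zero (by exact_mod_cast hqP)
    exact (hgood ⟨P, hP, hP0⟩ hqP).1
  have hπq : π.1.IsUnramifiedAbove (f w) := fun w' hw' ↦ (hgood w' hw').2
  exact not_HarrisLanTaylorThorne2016_twistedPairLimit_two_of_inertPlace Fp K cK hFp hdeg hc hK hcpt
    p E₀ hE₀ hsplit π hπ ι w hfix (f w) hq hqp (hf w).2 hKq hπq h

/-- **The corrected prescription passes the obstruction**: the constant coefficient of
`arithFrobPolyOfSatake ι q 2 (α · q^{-N}) · ∏_{b ∈ {b₁, b₂}} (X - b q^{-N})` does not depend on `N`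
(the factors `q^{2N}` and `q^{-2N}` cancel), for `α` of cardinality `2` and `q ≠ 0`. [folklore] -/
theorem eval_zero_inducedPair_prescription (ι : PadicAlgCl p ≃+* ℂ) {q : ℕ} (hq : 0 < q)
    {α : Multiset ℂ} (hα : Multiset.card α = 2) (b₁ b₂ : PadicAlgCl p) (N : ℕ) :
    (arithFrobPolyOfSatake ι q 2 (α.map fun a ↦ a * ((q : ℂ)⁻¹) ^ N) *
        (({b₁, b₂} : Multiset (PadicAlgCl p)).map fun b ↦
          X - C (b * ((q : PadicAlgCl p)⁻¹) ^ N)).prod).eval 0 =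
      (arithFrobPolyOfSatake ι q 2 α).eval 0 * (b₁ * b₂) := by
  obtain ⟨a₁, a₂, rfl⟩ := Multiset.card_eq_two.mp hα
  have hq0 : (q : PadicAlgCl p) ≠ 0 := by exact_mod_cast hq.ne'
  have hι : ∀ z : ℂ, ι.symm (z * ((q : ℂ)⁻¹) ^ N)⁻¹ = ι.symm z⁻¹ * (q : PadicAlgCl p) ^ N := by
    intro z
    rw [mul_inv, inv_pow, inv_inv, map_mul, map_pow, map_natCast]
  have hqN : (q : PadicAlgCl p) ^ N * ((q : PadicAlgCl p)⁻¹) ^ N = 1 := by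
    rw [← mul_pow, mul_inv_cancel₀ hq0, one_pow]
  unfold arithFrobPolyOfSatake
  simp only [Multiset.insert_eq_cons, Multiset.map_cons, Multiset.map_singleton, Multiset.prod_cons,
    Multiset.prod_singleton, Polynomial.eval_mul, Polynomial.eval_sub, Polynomial.eval_X,
    Polynomial.eval_C, ← mul_assoc _ _ (((q : ℂ)⁻¹) ^ N), hι]
  set s : ℂ := ((Real.sqrt (q : ℝ) : ℝ) : ℂ) ^ (2 - 1)
  set t : PadicAlgCl p := ((q : PadicAlgCl p)⁻¹) ^ N
  set u : PadicAlgCl p := (q : PadicAlgCl p) ^ N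
  linear_combination (ι.symm (s * a₁)⁻¹ * ι.symm (s * a₂)⁻¹ * b₁ * b₂) * (u * t + 1) * (hqN)

/-- `scaleRoots` of a multiset product of polynomials over a field is the product of the
`scaleRoots` (Mathlib `Polynomial.mul_scaleRoots_of_noZeroDivisors`, `Polynomial.one_scaleRoots`).
[folklore] -/
theorem multisetProd_scaleRoots {L ι' : Type*} [Field L] (m : Multiset ι') (f : ι' → L[X]) (s : L) :
    (m.map f).prod.scaleRoots s = (m.map fun i ↦ (f i).scaleRoots s).prod := by
  induction m using Multiset.induction_on with
  | empty => simp
  | cons a m ih =>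
    rw [Multiset.map_cons, Multiset.prod_cons, Multiset.map_cons, Multiset.prod_cons,
      Polynomial.mul_scaleRoots_of_noZeroDivisors, ih]

/-- **The corrected prescription is the Tate twist by `ε_p^{N}` of the typed one**: multiplying
every root of `arithFrobPolyOfSatake ι q 2 α · ∏_{b ∈ B} (X - b q^{-2N})` (the arithmetic-Frobenius
polynomial of Cor. 6.27's `R_{p,ı}(π, N) = r ⊕ r^{c,∨} ε_p^{1-2n-2N}`, the prescription of the typed
`HarrisLanTaylorThorne2016_twistedPairLimit_two`) by `q^{N} = ε_p^{N}(Frob^{arith})` gives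
`arithFrobPolyOfSatake ι q 2 (α q^{-N}) · ∏_{b ∈ B} (X - b q^{-N})` (that of
`R_p(ı⁻¹(π^∞‖det‖^N)) = R_{p,ı}(π, N) ⊗ ε_p^{N}`, the corrected prescription), for any multisets
`α`, `B` and `q ≠ 0`: "Take `R_{p,ı}(π, N) = R_p(ı⁻¹(π^∞‖det‖^N)) ⊗ ε_p^{-N}`".
[cite: HarrisLanTaylorThorneRMS2016, proof of Cor. 6.27 (p. 225)] -/
theorem inducedPairPrescription_eq_scaleRoots (ι : PadicAlgCl p ≃+* ℂ) {q : ℕ} (hq : 0 < q)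
    (α : Multiset ℂ) (B : Multiset (PadicAlgCl p)) (N : ℕ) :
    arithFrobPolyOfSatake ι q 2 (α.map fun a ↦ a * ((q : ℂ)⁻¹) ^ N) *
        (B.map fun b ↦ X - C (b * ((q : PadicAlgCl p)⁻¹) ^ N)).prod =
      (arithFrobPolyOfSatake ι q 2 α *
        (B.map fun b ↦ X - C (b * ((q : PadicAlgCl p)⁻¹) ^ (2 * N))).prod).scaleRoots
          ((q : PadicAlgCl p) ^ N) := by
  have hq0 : (q : PadicAlgCl p) ≠ 0 := by exact_mod_cast hq.ne'
  have hι : ∀ z : ℂ, ι.symm (z * ((q : ℂ)⁻¹) ^ N)⁻¹ = ι.symm z⁻¹ * (q : PadicAlgCl p) ^ N := by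
    intro z
    rw [mul_inv, inv_pow, inv_inv, map_mul, map_pow, map_natCast]
  have hqN : ∀ b : PadicAlgCl p,
      b * ((q : PadicAlgCl p)⁻¹) ^ (2 * N) * (q : PadicAlgCl p) ^ N = b * ((q : PadicAlgCl p)⁻¹) ^ N := by
    intro b
    rw [two_mul, pow_add, mul_assoc, mul_assoc, ← mul_pow, inv_mul_cancel₀ hq0, one_pow, mul_one]
  rw [Polynomial.mul_scaleRoots_of_noZeroDivisors, multisetProd_scaleRoots]
  unfold arithFrobPolyOfSatake
  rw [multisetProd_scaleRoots, Multiset.map_map]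
  congr 1
  · congr 1
    refine Multiset.map_congr rfl fun a _ ↦ ?_
    simp only [Function.comp_apply]
    rw [Polynomial.X_sub_C_scaleRoots, ← mul_assoc, hι]
  · congr 1
    refine Multiset.map_congr rfl fun b _ ↦ ?_
    rw [Polynomial.X_sub_C_scaleRoots, hqN]

-- names the `@[deprecated]` record `HarrisLanTaylorThorne2016_twistedPairLimit_two` of
-- `HarrisLanTaylorThorneTwistedPairLimit.lean` on purpose: this IS the characterisation its deprecation
-- message points to (verdict clean-up 2026-08-17); REMOVE-WHEN the record is deleted from that file
set_option linter.deprecated false in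
/-- **The typed fact is equivalent to the non-existence of its data.**
`HarrisLanTaylorThorne2016_twistedPairLimit_two` holds if and only if, for every CM presentation
`K/Fp` of its shape (`Fp` totally real, `[K:Fp] = 2`, involution `cK ≠ 1`, `K` totally complex),
every compact-level witness `hcpt`, every rational prime `p` and every imaginary quadratic
`E₀ ⊆ K` in which `p` splits, NO cuspidal automorphic representation of `GL₂(𝔸_K)` is regular
algebraic.  (`→`: `HarrisLanTaylorThorne2016_twistedPairLimit_two.elim` at an abstract field
isomorphism `ℚ̄_p ≃+* ℂ`, which exists by Steinitz, `PadicAlgCl.nonempty_ringEquiv_complex`;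
`←`: vacuously.)  So the fact, as typed, carries none of the content of Harris–Lan–Taylor–Thorne's
§6 — whose limit statement concerns `R_p(ı⁻¹(π^∞‖det‖^N)) = R_{p,ı}(π, N) ⊗ ε_p^{N}`, see the
module docstring and `inducedPairPrescription_eq_scaleRoots` — and is moreover false (e.g.
`Fp = ℚ`, `K = E₀ = ℚ(i)`, `p = 5`, `π` the base change to `ℚ(i)` of the non-CM newform of
weight `2` and level `11`); in the tree `¬` it is proved modulo Arthur–Clozel's quadratic base
change, `HarrisLanTaylorThorne2016_twistedPairLimit_two.not_of_arthurClozel` of the sibling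
`HarrisLanTaylorThorneTwistedPairLimitVsBaseChange.lean` (Ramanujan's `Δ` base-changed to `ℚ(√-23)`),
an unconditional `¬` awaiting a cuspidal `π` over a CM field constructed in the tree's own model.
[cite: HarrisLanTaylorThorneRMS2016, proof of Cor. 6.27 (p. 225)] -/
theorem HarrisLanTaylorThorne2016_twistedPairLimit_two_iff_forall_not_isRegularAlgebraic :
    HarrisLanTaylorThorne2016_twistedPairLimit_two ↔
      ∀ (Fp K : Type) [Field Fp] [NumberField Fp] [Field K] [NumberField K] [Algebra Fp K]
        (cK : K ≃ₐ[Fp] K), IsTotallyReal Fp → Module.finrank Fp K = 2 → cK ≠ 1 →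
        IsTotallyComplex K →
        ∀ (hcpt : isCompact_glFiniteIntegralLevel 2 K) (p : ℕ), p.Prime →
        ∀ E₀ : IntermediateField ℚ K, Module.finrank ℚ E₀ = 2 ∧ IsTotallyComplex E₀ →
          HasTwoPrimesOver E₀ p →
        ∀ π : CuspidalAutomorphicRepData 2 K hcpt, ¬ π.1.IsRegularAlgebraic := by
  constructor
  · intro h Fp K _ _ _ _ _ cK hFp hdeg hc hK hcpt p hp E₀ hE₀ hsplit π hπ
    haveI : Fact p.Prime := ⟨hp⟩
    obtain ⟨ι⟩ := PadicAlgCl.nonempty_ringEquiv_complex p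
    exact h.elim Fp K cK hFp hdeg hc hK hcpt p E₀ hE₀ hsplit π hπ ι
  · intro h Fp K _ _ _ _ _ cK hFp hdeg hc hK hcpt p _ E₀ hE₀ hsplit π hπ ι
    exact (h Fp K cK hFp hdeg hc hK hcpt p Fact.out E₀ hE₀ hsplit π hπ).elim

end Evidence

end Literature.NumberTheory.Automorphic

end
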